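import Summits.Ventures.CertifiedManyBodySolver.Observables.RungLeavesStiffnessAnchor
import Literature.MathematicalPhysics.QuantumLattice.HubbardOneBodyKinematicRows
import Literature.MathematicalPhysics.QuantumLattice.InfVolFermionStateHubbardEnergy
import Literature.MathematicalPhysics.QuantumLattice.HubbardKineticEnergyDensity
import HarnessLib

/-!
# Ventures/CertifiedManyBodySolver — Observables/StiffnessKinematicLeaf.lean

HONEST FRAMING: one-sided CEILINGS on the uniform flux stiffness at the KINEMATIC scale and a-priori kinetic floors; a ceiling never
speaks to the presence of order; not informative vs print; not a superconductivity verdict.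

Cell `hubbard-obs` (D-0042), seat p2 (stiffness), `prover-hubbard-obs-p2-g9-0`; for the burst's per-anchor stiffness add-on (lead RULING
(dk) d151 (dk2)/(dk4): «one-body reference per anchor, zero compute») and the a-priori companions of every kinetic edge. Two
NODE-FREE facts at an ARBITRARY anchor `(U, n, t′)`, read through the anchor-generic leaves of `Observables/RungLeavesStiffnessAnchor.lean`:

* §1 **The kinematic (one-body) stiffness leaf, UNCONDITIONAL** (no certificate, no claim node): for every coupling `U` and every
  density `0 ≤ n < 2`, `ObsStiffnessSeqCeilingAt 0 U n c` for every `c ≥ 4/π²`; numerically `ObsStiffnessSeqCeilingAt 0 U n 0.4052848`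
  — every uniform flux stiffness of the 2D Hubbard model at `t′ = 0` is `≤ 4/π² ≈ 0.4052847` tree units (HVR `≤ 2/π²`). Source: the
  hubbard-fast K₁ row `IsTorusLimitOf.neg_sixteen_div_pi_sq_le_meanEnergy_nnHop` (`−16/π² ≤ K₁(ω)` for every torus limit of unit
  fixed-density vectors: the half-filled free band, Lieb–Loss bathtub; `Literature/…/HubbardOneBodyKinematicRows.lean`) read as the bond-form
  kinetic floor `−16/π² ≤ k(ω)` (`torusLimit_negKinetic_le_sixteen_div_pi_sq`), then `ObsStiffnessSeqCeilingAt_tp0_of_kineticDensity_ge`.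
  (The density-specific bathtub `|e_free(n)|/4`, `0.4019425` at `n = 7/8`, is sharper but not a rational of the tree; `4/π²` is its
  `n = 1` maximum and holds at every `n`.) At `(8, 7/8)`: `M3ObsStiffnessCeilingAt_tp0 0.4052848` with NO premise — while the certified
  leaves of record read `0.3748013` (chord, #354 ∧ #426) / `0.3359318` (kinlo): the certificates are what take the ceiling below kinematics.
* §2 **The a-priori kinetic floor from an energy CAP alone** (`U ≥ 0`, `t′ = 0`): for every torus limit `ω` of unit sector ground
  states at `(U, n, 0)` with a certified cap `e₀(U, n, 0) ≤ hi`, `−k(ω) = −e₀ + U·D(ω) ≥ −hi` (`D = Re ω(n↑n↓) ≥ 0`,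
  `re_expect_docc_nonneg`): `torusLimit_neg_cap_le_negKinetic`; hence the CLASS FLOOR of the f-sum route at that anchor — every
  `X` bounding `−k` on the (inhabited) class has `−hi ≤ X` (`negKinetic_classFloor_of_energyCap`), i.e. no kinetic-route stiffness
  ceiling at `(U, n, 0)` can read below `−hi/4`; and the U-SEGMENT transport of the floor to every `U′ ∈ [0, U]`
  (`forall_torusLimit_le_negKinetic_of_coupling_le`). (At `(8, 7/8, 0)` the docc-floor version `8·d_lo − hi` of p433540 is better; at a
  fresh anchor with only a cap this is the zero-compute floor, e.g. A7 = (4, 7/8, 0): `−hi(#451) = 0.9731569575`, instance in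
  `Certificates/HubbardSquare_U4_n7o8_kinetic_apriori_r451.lean`.)

* §3 **The derived kinetic floor from a cap AND a docc floor** (generic anchor): `k(ω) = e₀(U,n,0) − U·D(ω)`
  (`torusLimit_kineticDensity_eq_energy_sub_docc`) and `U·d_lo − hi ≤ −k(ω)` from a certified docc floor `d_lo` plus the cap
  (`torusLimit_negKinetic_ge_of_doccFloor_of_cap`, row form `…_of_doccLowerRow_of_cap`) — the generic form of registry row 26; for a
  burst anchor whose K5 menu certifies `docc lo`, this upgrades the §2 floor at zero compute.

No definition, no named fact, zero computation, no `sorry`.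

References: E. H. Lieb, M. Loss, Analysis (AMS 1997/2001) §1.14 bathtub [LiebLoss1993]; D. J. Scalapino, S. R. White, S.-C. Zhang,
PRB 47 (1993) 7995, §II [ScalapinoWhiteZhang1993]; T. Koma, H. Tasaki, J. Stat. Phys. 76 (1994) 745, §1 [KomaTasaki1994];
O. Bratteli, D. W. Robinson II (1997) §6.2.4 [BratteliRobinsonII1997].
-/

noncomputable section

namespace Summit.Ventures.CertifiedManyBodySolver.Observables

open Matrix Finset Filter Topology
open Literature.MathematicalPhysics.QuantumLattice
open Literature.MathematicalPhysics.QuantumLattice.ThermodynamicLimit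
open Literature.Probability.LatticeModels
open scoped ComplexOrder ComplexConjugate Topology BigOperators

/-! ## §1 The kinematic stiffness leaf (no certificate) -/

/-- **Kinematic kinetic ceiling on every torus-limit ground-state class**: for every torus limit `ω` of unit
`(rectN n L, S^z = 0)`-sector ground states of `hubbardTorusTT' L 1 tp U` (`0 ≤ n < 2`; any `tp`, `U`), `−k(ω) ≤ 16/π²` (bond form; the
half-filled free band). The K₁ row of `HubbardOneBodyKinematicRows` read through `meanEnergy_hubbardTTPrime_oneBody_eq_kineticDensity`.
[cite: LiebLoss1993, §1.14] -/
theorem torusLimit_negKinetic_le_sixteen_div_pi_sq {tp U n : ℝ} (hn0 : 0 ≤ n) (hn2 : n < 2) :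
    ∀ (ω : InfVolFermionState 2) (Ls : ℕ → ℕ) (ψ : ∀ L, Fock (Orb (FermionTorus 2 L))),
      Tendsto Ls atTop atTop →
      (∀ j, IsGroundStateInSector (hubbardTorusTT' (Ls j) 1 tp U) (rectN n (Ls j)) 0 (ψ (Ls j))) →
      (∀ j, star (ψ (Ls j)) ⬝ᵥ ψ (Ls j) = 1) → ω.IsTorusLimitOf ψ Ls →
      -(∑ i : Fin 2, -(1 : ℝ) * ∑ σ : Fin 2,
          ((ω.expect {0, 0 + unitVec i}
              ((cAt 0 (mem_insert_self _ _) σ)ᴴ * cAt (0 + unitVec i) (mem_insert_of_mem (mem_singleton_self _)) σ)).re +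
            (ω.expect {0, 0 + unitVec i}
              ((cAt (0 + unitVec i) (mem_insert_of_mem (mem_singleton_self _)) σ)ᴴ * cAt 0 (mem_insert_self _ _) σ)).re)) ≤
        16 / Real.pi ^ 2 := by
  intro ω Ls ψ hLs hψ h1 hω
  have hN : ∀ j, IsNParticle (rectN n (Ls j)) (ψ (Ls j)) := fun j => ((mem_szSector_iff _ _ _).1 (hψ j).1).1
  have h := hω.neg_sixteen_div_pi_sq_le_meanEnergy_nnHop hn0 hn2 hLs hN h1
  rw [meanEnergy_hubbardTTPrime_oneBody_eq_kineticDensity hω.isTranslationInvariant] at h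
  rw [neg_div] at h
  linarith

/-- **THE KINEMATIC STIFFNESS LEAF, UNCONDITIONAL** (`t′ = 0`, any coupling `U`, density `0 ≤ n < 2`): `ObsStiffnessSeqCeilingAt 0 U n c`
for every `c ≥ 4/π²` — every flux stiffness `ρ_s > 0` whose flux inequality holds along some sequence of sides satisfies `ρ_s ≤ 4/π²`
(tree units; HVR `D_s ≤ 2/π²`; SWZ `D/(πe²) ≤ 8/π²`). No certificate, no claim node. [cite: ScalapinoWhiteZhang1993, §II] -/
theorem ObsStiffnessSeqCeilingAt_tp0_kinematic {U n : ℝ} (hn0 : 0 ≤ n) (hn2 : n < 2) (c : ℚ)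
    (hc : 4 / Real.pi ^ 2 ≤ ((c : ℚ) : ℝ)) : ObsStiffnessSeqCeilingAt 0 U n c := by
  have hc' : -(-(16 / Real.pi ^ 2)) / 4 ≤ ((c : ℚ) : ℝ) := by
    rw [show -(-(16 / Real.pi ^ 2)) / 4 = 4 / Real.pi ^ 2 by ring]; exact hc
  refine ObsStiffnessSeqCeilingAt_tp0_of_kineticDensity_ge hn2.le (-(16 / Real.pi ^ 2)) c hc'
    fun ω Ls ψ hLs hψ h1 hω => ?_
  have h := torusLimit_negKinetic_le_sixteen_div_pi_sq (tp := 0) (U := U) hn0 hn2 ω Ls ψ hLs hψ h1 hω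
  linarith

/-- The outward 7-dp decimal of the kinematic constant: `4/π² ≤ 0.4052848` (`π > 3.14159265358979323846`, Mathlib `Real.pi_gt_d20`).
[folklore] -/
theorem four_div_pi_sq_le_decimal : 4 / Real.pi ^ 2 ≤ (0.4052848 : ℝ) := by
  have hπ : (3.14159265358979323846 : ℝ) < Real.pi := Real.pi_gt_d20
  have hpos : (0 : ℝ) < Real.pi ^ 2 := by positivity
  have hsq : (9.869604401 : ℝ) < Real.pi ^ 2 := by nlinarith
  rw [div_le_iff₀ hpos]
  linarith

/-- **Numerical kinematic leaf**: `ObsStiffnessSeqCeilingAt 0 U n 0.4052848` at EVERY `t′ = 0` anchor (`0 ≤ n < 2`, any `U`), no premise.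
[cite: ScalapinoWhiteZhang1993, §II] -/
theorem ObsStiffnessSeqCeilingAt_tp0_kinematic_decimal {U n : ℝ} (hn0 : 0 ≤ n) (hn2 : n < 2) :
    ObsStiffnessSeqCeilingAt 0 U n (4052848 / 10000000) :=
  ObsStiffnessSeqCeilingAt_tp0_kinematic hn0 hn2 _ (by
    have h := four_div_pi_sq_le_decimal
    have he : (((4052848 / 10000000 : ℚ)) : ℝ) = (0.4052848 : ℝ) := by norm_num
    rw [he]; exact h)

/-- The all-even-sides form at every `t′ = 0` anchor, no premise. -/
theorem ObsStiffnessCeilingAt_tp0_kinematic_decimal {U n : ℝ} (hn0 : 0 ≤ n) (hn2 : n < 2) :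
    ObsStiffnessCeilingAt 0 U n (4052848 / 10000000) :=
  (ObsStiffnessSeqCeilingAt_tp0_kinematic_decimal hn0 hn2).ceilingAt

/-- **At `(8, 7/8, 0)`, NO premise**: `M3ObsStiffnessCeilingAt_tp0 0.4052848` — the registry's leaf shape at the kinematic constant; the
certified leaves of record (chord `0.3748013`, kinlo `0.3359318`) lie strictly below it (that difference is what the certificates buy).
[cite: ScalapinoWhiteZhang1993, §II] -/
theorem M3ObsStiffnessCeilingAt_tp0_kinematic_decimal : M3ObsStiffnessCeilingAt_tp0 (4052848 / 10000000) :=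
  (ObsStiffnessSeqCeilingAt_tp0_kinematic_decimal (U := 8) (n := 7 / 8) (by norm_num) (by norm_num)).m3_tp0

/-- Literal comparison (decidable): the certified leaf constants of record at `(8, 7/8, 0)` are below the kinematic `0.4052848`:
chord `906213886029816052260099/2⁸¹ < 0.4052848`, kinlo `223264916321536523710802363374151687/2¹¹⁹ < 0.4052848`. -/
theorem m3_tp0_certifiedLeaves_lt_kinematic :
    (906213886029816052260099 / 2417851639229258349412352 : ℚ) < 4052848 / 10000000 ∧
      (223264916321536523710802363374151687 / 664613997892457936451903530140172288 : ℚ) < 4052848 / 10000000 := by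
  norm_num

/-! ## §2 The a-priori kinetic floor from an energy cap alone (`t′ = 0`, `U ≥ 0`) -/

/-- **`−k(ω) ≥ −hi` from a cap**: `U ≥ 0`, `0 ≤ n < 2`; for every torus limit `ω` of unit `(rectN n L, S^z = 0)`-sector ground states of
`hubbardTorusTT' L 1 0 U` and every certified cap `e₀(U, n, 0) ≤ hi`: `−hi ≤ −k(ω)` — since `k(ω) = e₀ − U·D(ω)`
(`IsTorusLimitOf.hubbardEnergyDensity_eq_energyDensity2D`, `IsTranslationInvariant.hubbardEnergyDensity_eq_docc_add_hopping`) and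
`D(ω) = Re ω(n↑n↓) ≥ 0` (`InfVolFermionState.re_expect_docc_nonneg`). [cite: KomaTasaki1994, §1] -/
theorem torusLimit_neg_cap_le_negKinetic {U n : ℝ} (hU : 0 ≤ U) (hn0 : 0 ≤ n) (hn2 : n < 2) {hi : ℚ}
    (hcap : energyDensityTT' 1 0 U n ≤ ((hi : ℚ) : ℝ)) :
    ∀ (ω : InfVolFermionState 2) (Ls : ℕ → ℕ) (ψ : ∀ L, Fock (Orb (FermionTorus 2 L))),
      Tendsto Ls atTop atTop →
      (∀ j, IsGroundStateInSector (hubbardTorusTT' (Ls j) 1 0 U) (rectN n (Ls j)) 0 (ψ (Ls j))) →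
      (∀ j, star (ψ (Ls j)) ⬝ᵥ ψ (Ls j) = 1) → ω.IsTorusLimitOf ψ Ls →
      -((hi : ℚ) : ℝ) ≤ -(∑ i : Fin 2, -(1 : ℝ) * ∑ σ : Fin 2,
          ((ω.expect {0, 0 + unitVec i}
              ((cAt 0 (mem_insert_self _ _) σ)ᴴ * cAt (0 + unitVec i) (mem_insert_of_mem (mem_singleton_self _)) σ)).re +
            (ω.expect {0, 0 + unitVec i}
              ((cAt (0 + unitVec i) (mem_insert_of_mem (mem_singleton_self _)) σ)ᴴ * cAt 0 (mem_insert_self _ _) σ)).re)) := by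
  intro ω Ls ψ hLs hψ h1 hω
  have hψ' : ∀ j, IsGroundStateInSector (hubbardTorus 2 (Ls j) 1 U) (rectN n (Ls j)) 0 (ψ (Ls j)) := fun j => by
    simpa only [hubbardTorusTT'_zero] using hψ j
  have he : ω.hubbardEnergyDensity 1 U = energyDensity2D 1 U n :=
    hω.hubbardEnergyDensity_eq_energyDensity2D 1 hLs hU hn0 hn2 hψ' h1
  have hsplit := hω.isTranslationInvariant.hubbardEnergyDensity_eq_docc_add_hopping 1 U
  have hdocc := InfVolFermionState.re_expect_docc_nonneg ω
  have hcap' : energyDensity2D 1 U n ≤ ((hi : ℚ) : ℝ) := by rw [← energyDensityTT'_zero]; exact hcap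
  have hUd : 0 ≤ U * (ω.expect ({0} : Finset (Site 2))
      (nAt (0 : Site 2) (mem_singleton_self 0) 0 * nAt 0 (mem_singleton_self 0) 1)).re := mul_nonneg hU hdocc
  rw [he] at hsplit
  linarith

/-- **CLASS FLOOR of the f-sum route from a cap alone**: `U ≥ 0`, `0 ≤ n < 2`, cap `e₀(U, n, 0) ≤ hi`. Every real `X` that bounds `−k` from
above on the torus-limit ground-state class at `(U, n, 0)` — what ANY certified kinetic ceiling there delivers, whatever the host, level or
window — satisfies `−hi ≤ X` (the class is inhabited, `exists_isTorusLimitOf_sectorGroundState_TT'`); so no kinetic-route stiffness ceiling at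
`(U, n, 0)` can read below `−hi/4`. [cite: KomaTasaki1994, §1] -/
theorem negKinetic_classFloor_of_energyCap {U n : ℝ} (hU : 0 ≤ U) (hn0 : 0 ≤ n) (hn2 : n < 2) {hi : ℚ}
    (hcap : energyDensityTT' 1 0 U n ≤ ((hi : ℚ) : ℝ)) {X : ℝ}
    (hX : ∀ (ω : InfVolFermionState 2) (Ls : ℕ → ℕ) (ψ : ∀ L, Fock (Orb (FermionTorus 2 L))),
      Tendsto Ls atTop atTop →
      (∀ j, IsGroundStateInSector (hubbardTorusTT' (Ls j) 1 0 U) (rectN n (Ls j)) 0 (ψ (Ls j))) →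
      (∀ j, star (ψ (Ls j)) ⬝ᵥ ψ (Ls j) = 1) → ω.IsTorusLimitOf ψ Ls →
      -(∑ i : Fin 2, -(1 : ℝ) * ∑ σ : Fin 2,
          ((ω.expect {0, 0 + unitVec i}
              ((cAt 0 (mem_insert_self _ _) σ)ᴴ * cAt (0 + unitVec i) (mem_insert_of_mem (mem_singleton_self _)) σ)).re +
            (ω.expect {0, 0 + unitVec i}
              ((cAt (0 + unitVec i) (mem_insert_of_mem (mem_singleton_self _)) σ)ᴴ * cAt 0 (mem_insert_self _ _) σ)).re)) ≤ X) :
    -((hi : ℚ) : ℝ) ≤ X ∧ -((hi : ℚ) : ℝ) / 4 ≤ X / 4 := by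
  obtain ⟨ψ, φ, ω, hφ, hψ, hψ1, hω, -, -, -⟩ :=
    exists_isTorusLimitOf_sectorGroundState_TT' 1 0 U hn0 hn2.le (Ls := id) tendsto_id
  have hLφ : Tendsto (id ∘ φ : ℕ → ℕ) atTop atTop := tendsto_id.comp hφ.tendsto_atTop
  have hlo := torusLimit_neg_cap_le_negKinetic hU hn0 hn2 hcap ω (id ∘ φ) ψ hLφ (fun j => hψ _) (fun j => hψ1 _) hω
  have hup := hX ω (id ∘ φ) ψ hLφ (fun j => hψ _) (fun j => hψ1 _) hω
  constructor <;> linarith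

/-- **U-segment transport of the cap floor**: under the hypotheses of `torusLimit_neg_cap_le_negKinetic` at `U₀ ≥ 0`, for every
`U ∈ [0, U₀]` and every torus-limit ground state at `(U, n, 0)`: `−hi ≤ −k` (the kinetic energy `⟨−T⟩` is non-increasing in `U`,
`forall_torusLimit_le_negKinetic_of_coupling_le`). [cite: KomaTasaki1994, §1] -/
theorem torusLimit_neg_cap_le_negKinetic_on_segment {U₀ U n : ℝ} (hU0 : 0 ≤ U) (hU : U ≤ U₀) (hn0 : 0 ≤ n) (hn2 : n < 2)
    {hi : ℚ} (hcap : energyDensityTT' 1 0 U₀ n ≤ ((hi : ℚ) : ℝ)) :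
    ∀ (ω : InfVolFermionState 2) (Ls : ℕ → ℕ) (ψ : ∀ L, Fock (Orb (FermionTorus 2 L))),
      Tendsto Ls atTop atTop →
      (∀ j, IsGroundStateInSector (hubbardTorusTT' (Ls j) 1 0 U) (rectN n (Ls j)) 0 (ψ (Ls j))) →
      (∀ j, star (ψ (Ls j)) ⬝ᵥ ψ (Ls j) = 1) → ω.IsTorusLimitOf ψ Ls →
      -((hi : ℚ) : ℝ) ≤ -(∑ i : Fin 2, -(1 : ℝ) * ∑ σ : Fin 2,
          ((ω.expect {0, 0 + unitVec i}
              ((cAt 0 (mem_insert_self _ _) σ)ᴴ * cAt (0 + unitVec i) (mem_insert_of_mem (mem_singleton_self _)) σ)).re +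
            (ω.expect {0, 0 + unitVec i}
              ((cAt (0 + unitVec i) (mem_insert_of_mem (mem_singleton_self _)) σ)ᴴ * cAt 0 (mem_insert_self _ _) σ)).re)) :=
  forall_torusLimit_le_negKinetic_of_coupling_le hU0 hU hn0 hn2
    (torusLimit_neg_cap_le_negKinetic (hU0.trans hU) hn0 hn2 hcap)

/-! ## §3 The derived kinetic floor from a cap AND a docc floor (generic anchor, `t′ = 0`, `U ≥ 0`) -/

/-- **`k(ω) = e₀(U, n, 0) − U·D(ω)`** for every torus limit `ω` of unit `(rectN n L, S^z = 0)`-sector ground states of `hubbardTorusTT' L 1 0 U`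
(`U ≥ 0`, `0 ≤ n < 2`; `D(ω) = Re ω(doccAt0) = Re ω(n↑n↓)`) — the generic form of the M3′ identity `m3_tp0_kineticDensity_eq`
(`IsTorusLimitOf.hubbardEnergyDensity_eq_energyDensity2D` + `IsTranslationInvariant.hubbardEnergyDensity_eq_docc_add_hopping`).
[cite: BratteliRobinsonII1997, §6.2.4] -/
theorem torusLimit_kineticDensity_eq_energy_sub_docc {U n : ℝ} (hU : 0 ≤ U) (hn0 : 0 ≤ n) (hn2 : n < 2) :
    ∀ (ω : InfVolFermionState 2) (Ls : ℕ → ℕ) (ψ : ∀ L, Fock (Orb (FermionTorus 2 L))),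
      Tendsto Ls atTop atTop →
      (∀ j, IsGroundStateInSector (hubbardTorusTT' (Ls j) 1 0 U) (rectN n (Ls j)) 0 (ψ (Ls j))) →
      (∀ j, star (ψ (Ls j)) ⬝ᵥ ψ (Ls j) = 1) → ω.IsTorusLimitOf ψ Ls →
      (∑ i : Fin 2, -(1 : ℝ) * ∑ σ : Fin 2,
          ((ω.expect {0, 0 + unitVec i}
              ((cAt 0 (mem_insert_self _ _) σ)ᴴ * cAt (0 + unitVec i) (mem_insert_of_mem (mem_singleton_self _)) σ)).re +
            (ω.expect {0, 0 + unitVec i}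
              ((cAt (0 + unitVec i) (mem_insert_of_mem (mem_singleton_self _)) σ)ᴴ * cAt 0 (mem_insert_self _ _) σ)).re)) =
        energyDensityTT' 1 0 U n - U * (ω.expect ({0} : Finset (Site 2)) (doccAt0 2)).re := by
  intro ω Ls ψ hLs hψ h1 hω
  have hψ' : ∀ j, IsGroundStateInSector (hubbardTorus 2 (Ls j) 1 U) (rectN n (Ls j)) 0 (ψ (Ls j)) := fun j => by
    simpa only [hubbardTorusTT'_zero] using hψ j
  have he : ω.hubbardEnergyDensity 1 U = energyDensity2D 1 U n :=
    hω.hubbardEnergyDensity_eq_energyDensity2D 1 hLs hU hn0 hn2 hψ' h1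
  have hsplit := hω.isTranslationInvariant.hubbardEnergyDensity_eq_docc_add_hopping 1 U
  have hdocc : (ω.expect ({0} : Finset (Site 2)) (doccAt0 2)).re =
      (ω.expect {0} (nAt 0 (mem_singleton_self 0) 0 * nAt 0 (mem_singleton_self 0) 1)).re := rfl
  rw [energyDensityTT'_zero, ← he, hdocc, hsplit]
  ring

/-- **Derived kinetic FLOOR `−k(ω) ≥ U·d_lo − hi`** at a generic anchor `(U, n, 0)` (`U ≥ 0`, `0 ≤ n < 2`): a certified cap `e₀ ≤ hi` and a
certified docc floor `d_lo ≤ D(ω)` on the torus-limit ground-state class give `U·d_lo − hi ≤ −k(ω)` for every state of the class — the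
generic form of registry row 26 (`m3_tp0_kineticDensity_le_derived_r354_r261`, `8·d_lo(#261) − hi(#354)`); with `d_lo = 0` it is
`torusLimit_neg_cap_le_negKinetic`. The f-sum CLASS FLOOR then reads `(U·d_lo − hi)/4`. [cite: KomaTasaki1994, §1] -/
theorem torusLimit_negKinetic_ge_of_doccFloor_of_cap {U n : ℝ} (hU : 0 ≤ U) (hn0 : 0 ≤ n) (hn2 : n < 2) {hi : ℚ} {dlo : ℝ}
    (hcap : energyDensityTT' 1 0 U n ≤ ((hi : ℚ) : ℝ))
    (hd : ∀ (ω : InfVolFermionState 2) (Ls : ℕ → ℕ) (ψ : ∀ L, Fock (Orb (FermionTorus 2 L))),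
      Tendsto Ls atTop atTop →
      (∀ j, IsGroundStateInSector (hubbardTorusTT' (Ls j) 1 0 U) (rectN n (Ls j)) 0 (ψ (Ls j))) →
      (∀ j, star (ψ (Ls j)) ⬝ᵥ ψ (Ls j) = 1) → ω.IsTorusLimitOf ψ Ls →
      dlo ≤ (ω.expect ({0} : Finset (Site 2)) (doccAt0 2)).re) :
    ∀ (ω : InfVolFermionState 2) (Ls : ℕ → ℕ) (ψ : ∀ L, Fock (Orb (FermionTorus 2 L))),
      Tendsto Ls atTop atTop →
      (∀ j, IsGroundStateInSector (hubbardTorusTT' (Ls j) 1 0 U) (rectN n (Ls j)) 0 (ψ (Ls j))) →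
      (∀ j, star (ψ (Ls j)) ⬝ᵥ ψ (Ls j) = 1) → ω.IsTorusLimitOf ψ Ls →
      U * dlo - ((hi : ℚ) : ℝ) ≤ -(∑ i : Fin 2, -(1 : ℝ) * ∑ σ : Fin 2,
          ((ω.expect {0, 0 + unitVec i}
              ((cAt 0 (mem_insert_self _ _) σ)ᴴ * cAt (0 + unitVec i) (mem_insert_of_mem (mem_singleton_self _)) σ)).re +
            (ω.expect {0, 0 + unitVec i}
              ((cAt (0 + unitVec i) (mem_insert_of_mem (mem_singleton_self _)) σ)ᴴ * cAt 0 (mem_insert_self _ _) σ)).re)) := by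
  intro ω Ls ψ hLs hψ h1 hω
  rw [torusLimit_kineticDensity_eq_energy_sub_docc hU hn0 hn2 ω Ls ψ hLs hψ h1 hω]
  have hdω := hd ω Ls ψ hLs hψ h1 hω
  have hmul : U * dlo ≤ U * (ω.expect ({0} : Finset (Site 2)) (doccAt0 2)).re := mul_le_mul_of_nonneg_left hdω hU
  linarith

/-- **Row form**: the docc floor as a registry cell `SquareTTPrimeCorrLowerRow 0 U n u d_lo {0} doccAt0` (its own energy hypothesis `e₀ ≤ u`
discharged by `hu`) plus the cap `e₀ ≤ hi` give `U·d_lo − hi ≤ −k(ω)` on the class. [cite: KomaTasaki1994, §1] -/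
theorem torusLimit_negKinetic_ge_of_doccLowerRow_of_cap {U n : ℝ} (hU : 0 ≤ U) (hn0 : 0 ≤ n) (hn2 : n < 2) {hi u dlo : ℚ}
    (hcap : energyDensityTT' 1 0 U n ≤ ((hi : ℚ) : ℝ)) (hu : energyDensityTT' 1 0 U n ≤ ((u : ℚ) : ℝ))
    (hrow : SquareTTPrimeCorrLowerRow 0 U n u dlo {0} (doccAt0 2)) :
    ∀ (ω : InfVolFermionState 2) (Ls : ℕ → ℕ) (ψ : ∀ L, Fock (Orb (FermionTorus 2 L))),
      Tendsto Ls atTop atTop →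
      (∀ j, IsGroundStateInSector (hubbardTorusTT' (Ls j) 1 0 U) (rectN n (Ls j)) 0 (ψ (Ls j))) →
      (∀ j, star (ψ (Ls j)) ⬝ᵥ ψ (Ls j) = 1) → ω.IsTorusLimitOf ψ Ls →
      U * ((dlo : ℚ) : ℝ) - ((hi : ℚ) : ℝ) ≤ -(∑ i : Fin 2, -(1 : ℝ) * ∑ σ : Fin 2,
          ((ω.expect {0, 0 + unitVec i}
              ((cAt 0 (mem_insert_self _ _) σ)ᴴ * cAt (0 + unitVec i) (mem_insert_of_mem (mem_singleton_self _)) σ)).re +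
            (ω.expect {0, 0 + unitVec i}
              ((cAt (0 + unitVec i) (mem_insert_of_mem (mem_singleton_self _)) σ)ᴴ * cAt 0 (mem_insert_self _ _) σ)).re)) :=
  torusLimit_negKinetic_ge_of_doccFloor_of_cap hU hn0 hn2 hcap
    (fun ω Ls ψ hLs hψ h1 hω => hrow ω Ls ψ hLs hψ h1 hω hu)

end Summit.Ventures.CertifiedManyBodySolver.Observables

end
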